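import Summits.BirchSwinnertonDyer.Rank1Residual.X11b.BDPRouteUpperLinksFieldAll
import Summits.BirchSwinnertonDyer.Rank1Residual.X2.TwistKodaira
import Literature.NumberTheory.EllipticCurves.NonsplitProofs
import Literature.NumberTheory.EllipticCurves.RootNumberTwistProofs
import Literature.NumberTheory.EllipticCurves.PAdicBSDSplitMultiplicativeProofs
import Literature.NumberTheory.EllipticCurves.TamagawaRingEquivProofs
import Literature.NumberTheory.QuadraticFields.FundamentalDiscriminant
import HarnessLib

/-!
# X11b at an ODD prime `p` (`p = 3` included): the Tamagawa bookkeeping of the Shimura road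
# without Kodaira–Néron's `c ≤ 4 < p` (cell `b2b-bsdres`, team `x11b3` (N8/O2), seat `x11b3-p8`)

HONEST FRAMING (verbatim, cell `b2b-bsdres`, run/shared/lean/b2b/bsd-rank1-residual/): the goal of
the cell is to DELETE the COMBINATION-SHAPED residual classes for ALL analytic-rank `≤ 1` curves
over `ℚ` — "full BSD formula for every rank `≤ 1` curve in class `C`" assembled STRICTLY from
published theorems — so that the rank-`≤ 1` remainder becomes exactly the CONSTRUCTION-SHAPED
classes, which are TYPED (missing-input Props), NOT attempted; this is not "finishing BSD".
Research route `p2` for class X11b at `p = 3` (team x11b3, sub-target T-O2-T2SHARP@3 of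
`cells/x11b3/OWNERS.md`); no claim beyond the stated class and loci; nothing booked; X11 ∧ `r = 1`
at `p = 3` stays CONSTRUCTION-SHAPED (REFEREE R6.2), O2 OPEN. THEOREMS ONLY (no definition, no
named fact, no `sorry`).

## What this file does

Multr1-p2 reduced the Euler-system half (T2) of `BSD(E,p)` on the X11b sub-shape (ram) ∧ ¬(T2α) to
the Shimura displays (`BDPRouteUpperLinksFieldAll`, `BDPRouteUpperGZRealEnd`, `BDPRouteRecordDelta`)
for `p ≥ 5`. Read line by line, that chain's `5 ≤ p` is load-bearing in EXACTLY ONE way: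
Kodaira–Néron's `0 < c ≤ 4` off the split multiplicative primes, used as "`p ∤ c`" in the four local
lemmas behind `padicValNat_tamagawaProduct_add_twist_le_of_inertSet'`. At `p = 3` (`c = 3` at Kodaira
types IV, IV*) this file proves the four lemmas and the numeric condition at EVERY ODD `p` instead from:
a NON-split multiplicative prime has `c ∈ {1,2}` (tree fact
`localTamagawaNumber_of_hasNonsplitMultiplicativeReductionAt_holds`); at a good prime `q` of `E` and an
ODD `d_K`, `c_q(E^{d_K}) = 1` if `q ∤ d_K` and Kodaira `I₀*` with `ord_p c = 0` if `q ∣ d_K`, `q ≥ 5`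
(sub-cell eisenstein-p2's `X2.localTamagawaNumber_twist_of_not_dvd`,
`X2.padicValNat_localTamagawaNumber_twist_of_dvd` — "the case `p = 3` being the point"); and at a bad
prime split in `K` the TAMAGAWA SHAPE hypothesis "`p ∣ c_q(E) ⇒` split multiplicative at `q`" (a
theorem at `p ≥ 5`; at `p = 3` the exclusion of additive primes of type IV/IV* with `c = 3` — the
sub-atom ¬(T2γ)@3 of seat x11b3-p3's localisation). Nothing is specific to `p = 3` except that `p = 3`
is now ALLOWED; no named fact beyond the sibling files' tree theorems; nothing booked; labels unchanged.

References: [SilvermanATAEC1994] IV.9.4 Steps 2, 6, Cor. IV.9.2; [SilvermanAEC2009] VII.1 Prop. 1.3,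
VII.5 Prop. 5.1; [JetchevSkinnerWan2017] §7.4.2 (arXiv:1512.06894 p. 31), §7.3.1 (eq:tamK).
-/

noncomputable section

open scoped Classical

open WeierstrassCurve NumberField IsDedekindDomain IsDedekindDomain.HeightOneSpectrum
  Literature.NumberTheory.EllipticCurves Rat.HeightOneSpectrum
  Literature.NumberTheory.EllipticCurves.Rank1Residual
  Literature.NumberTheory.DiophantineGeometry

namespace Summit.BirchSwinnertonDyer.Rank1Residual.X11b

/-! ### A non-split multiplicative prime contributes nothing at an odd `p` -/

section Nonsplit

variable (W : WeierstrassCurve ℚ) [W.IsElliptic] (ℓ : ℕ) [Fact ℓ.Prime] (p : ℕ) [Fact p.Prime]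

/-- **At a multiplicative prime `ℓ` where `E` is NOT split, `ord_p c_ℓ(E) = 0` for every odd `p`.**
Tate's algorithm, Step 2 (Silverman *ATAEC* IV.9.4; tree fact
`localTamagawaNumber_of_hasNonsplitMultiplicativeReductionAt_holds`): `c_ℓ = 2` if `ord_ℓ Δ_min` is
even, `1` otherwise; transported from the place `v` of `𝓞 ℚ` over `ℓ` to `ℚ_ℓ`
(`localTamagawaNumber_padic_eq_holds`, `hasMultiplicativeReductionAtPrime_iff_…`,
`hasSplitMultiplicativeReductionAtPrime_iff_…`). Replaces Kodaira–Néron's `c ≤ 4 < p` at `p = 3`.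
[cite: SilvermanATAEC1994, IV.9.4 Step 2 (PDF p. 344)] -/
theorem padicValNat_localTamagawaNumber_eq_zero_of_mult_of_not_split (hp2 : p ≠ 2)
    (hmult : W.HasMultiplicativeReductionAtPrime ℓ)
    (hns : ¬ W.HasSplitMultiplicativeReductionAtPrime ℓ) :
    padicValNat p ((W.baseChange ℚ_[ℓ]).localTamagawaNumber ℤ_[ℓ]) = 0 := by
  have hpP : p.Prime := Fact.out
  obtain ⟨v, hv⟩ : ∃ v : HeightOneSpectrum (𝓞 ℚ), ((primesEquiv v : ℕ)) = ℓ :=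
    ⟨primesEquiv.symm ⟨ℓ, Fact.out⟩, by rw [Equiv.apply_symm_apply]⟩
  subst hv
  have hmult' : W.HasMultiplicativeReductionAt v :=
    (hasMultiplicativeReductionAtPrime_iff_hasMultiplicativeReductionAt_ringOfIntegers (W := W) v).mp
      hmult
  have hns' : ¬ W.HasSplitMultiplicativeReductionAt v := fun h ↦
    hns ((hasSplitMultiplicativeReductionAtPrime_iff_hasSplitMultiplicativeReductionAt W v).mpr h)
  haveI : Finite (IsLocalRing.ResidueField (v.adicCompletionIntegers ℚ)) :=
    HeightOneSpectrum.finite_residueField_adicCompletionIntegers ℚ v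
  have hc := localTamagawaNumber_of_hasNonsplitMultiplicativeReductionAt_holds v W hmult' hns'
  rw [localTamagawaNumber_padic_eq_holds W v _ rfl, hc]
  have hp2' : ¬ p ∣ 2 := fun h ↦ hp2 ((Nat.prime_dvd_prime_iff_eq hpP Nat.prime_two).mp h)
  split_ifs
  · exact padicValNat.eq_zero_of_not_dvd hp2'
  · simp

end Nonsplit

/-! ### The unit twist at an inert prime (odd, or `2` with `d_K ≡ 5 mod 8`), odd `p` -/

section Inert

variable (W : WeierstrassCurve ℚ) [W.IsElliptic] [W.IsGloballyMinimal]
  (K : Type) [Field K] [NumberField K]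
  {Wd : WeierstrassCurve ℚ} [Wd.IsElliptic] [Wd.IsGloballyMinimal] (Cd : VariableChange ℚ)
  (hWd : Cd • W.quadraticTwist (NumberField.discr K : ℚ) = Wd)
  (ℓ : ℕ) [Fact ℓ.Prime] (hℓ2 : ℓ ≠ 2) (hJ : jacobiSym (NumberField.discr K) ℓ = -1)

include hWd hℓ2 hJ

/-- **At an odd inert multiplicative prime the two Tamagawa exponents add up to at most
`ord_p(ord_ℓ Δ_min(E))`, for every ODD `p`** (multr1-p2's `…_le_of_inert` with `5 ≤ p ↦ p ≠ 2`):
`d_K` is a non-square `ℓ`-adic unit, so exactly one of `E ⊗ ℚ_ℓ`, `E^{d_K} ⊗ ℚ_ℓ` is split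
multiplicative, with `c_ℓ = ord_ℓ Δ_min(E)`; the NON-split one has `c_ℓ ∈ {1,2}`, prime to `p`.
[cite: SilvermanATAEC1994, IV.9.4 Step 2 (PDF p. 344) and Cor. IV.9.2(d) (PDF p. 340)]
[cite: SilvermanAEC2009, VII.5 Prop. 5.1(b) and VII.1 Prop. 1.3(b)] -/
theorem padicValNat_localTamagawaNumber_add_twist_le_of_inert_odd (p : ℕ) [Fact p.Prime]
    (hp2 : p ≠ 2) (hmult : Mult W ℓ) :
    padicValNat p ((W.baseChange ℚ_[ℓ]).localTamagawaNumber ℤ_[ℓ]) +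
        padicValNat p ((Wd.baseChange ℚ_[ℓ]).localTamagawaNumber ℤ_[ℓ]) ≤
      padicValNat p (padicValInt ℓ W.minimalDiscriminantInt) := by
  set d : ℤ := NumberField.discr K with hd_def
  have hℓd : ¬ (ℓ : ℤ) ∣ d := not_dvd_of_jacobiSym_eq_neg_one hJ
  have hd0 : d ≠ 0 := by rw [hd_def]; exact NumberField.discr_ne_zero K
  have hD0 : (d : ℚ) ≠ 0 := by exact_mod_cast hd0
  haveI : (W.quadraticTwist (d : ℚ)).IsElliptic := W.isElliptic_quadraticTwist hD0
  haveI : (W.baseChange ℚ_[ℓ]).IsElliptic := inferInstanceAs (W.map (algebraMap ℚ ℚ_[ℓ])).IsElliptic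
  haveI : (Wd.baseChange ℚ_[ℓ]).IsElliptic := inferInstanceAs (Wd.map (algebraMap ℚ ℚ_[ℓ])).IsElliptic
  haveI := finite_residueField_padicInt ℓ
  set u : ℤ_[ℓ]ˣ := (isUnit_intCast_padicInt_of_not_dvd hℓd).unit with hu_def
  have hu : (u : ℤ_[ℓ]) = (d : ℤ_[ℓ]) := rfl
  have hu' : algebraMap ℤ_[ℓ] ℚ_[ℓ] (u : ℤ_[ℓ]) = algebraMap ℚ ℚ_[ℓ] (d : ℚ) := by rw [hu]; simp
  have hnsq : ¬ IsSquare (IsLocalRing.residue ℤ_[ℓ] (u : ℤ_[ℓ])) := by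
    rw [hu]; exact not_isSquare_residue_of_jacobiSym_eq_neg_one hJ
  set X : WeierstrassCurve ℚ_[ℓ] := W.baseChange ℚ_[ℓ] with hX
  set Y : WeierstrassCurve ℚ_[ℓ] := Wd.baseChange ℚ_[ℓ] with hY
  haveI hXmin : X.IsMinimal ℤ_[ℓ] := isMinimal_map_padic_of_isGloballyMinimal W ℓ
  haveI hYmin : Y.IsMinimal ℤ_[ℓ] := isMinimal_map_padic_of_isGloballyMinimal Wd ℓ
  set Y' : WeierstrassCurve ℚ_[ℓ] := X.quadraticTwist (algebraMap ℤ_[ℓ] ℚ_[ℓ] (u : ℤ_[ℓ])) with hY'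
  haveI hY'min : Y'.IsMinimal ℤ_[ℓ] := isMinimal_quadraticTwist ℤ_[ℓ] X (isUnit_two_padicInt hℓ2) u
  have hX0 : X.Δ ≠ 0 := by
    rw [hX, baseChange, map_Δ, ← cast_minimalDiscriminantInt W, map_intCast]
    exact_mod_cast minimalDiscriminantInt_ne_zero W
  have hY'0 : Y'.Δ ≠ 0 := by
    rw [hY', quadraticTwist_Δ]; exact mul_ne_zero (pow_ne_zero 6 (by rw [hu']; exact (map_ne_zero _).mpr hD0)) hX0
  have hYY' : Y = Cd.map (algebraMap ℚ ℚ_[ℓ]) • Y' := by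
    rw [hY, ← hWd, WeierstrassCurve.VariableChange.baseChange_smul_eq (W.quadraticTwist (d : ℚ)) Cd
      ℚ_[ℓ], baseChange, map_quadraticTwist, ← hu', hY', hX, baseChange]
  obtain ⟨C₁, hC₁⟩ : ∃ C : VariableChange ℚ_[ℓ], X.minimal ℤ_[ℓ] = C • X := ⟨_, rfl⟩
  obtain ⟨C₂, hC₂⟩ : ∃ C : VariableChange ℚ_[ℓ], Y.minimal ℤ_[ℓ] = C • Y := ⟨_, rfl⟩
  have hC₂' : Y.minimal ℤ_[ℓ] = (C₂ * Cd.map (algebraMap ℚ ℚ_[ℓ])) • Y' := by rw [hC₂, hYY', mul_smul]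
  have hXmult : X.HasMultiplicativeReduction ℤ_[ℓ] :=
    (hasMultiplicativeReduction_iff_of_isMinimal_of_eq_smul ℤ_[ℓ] hC₁ hX0).mp hmult
  have hY'mult : Y'.HasMultiplicativeReduction ℤ_[ℓ] :=
    (hasMultiplicativeReduction_quadraticTwist_iff (R := ℤ_[ℓ]) (X := X) (d := u)).mpr hXmult
  have hsplit : Y'.HasSplitMultiplicativeReduction ℤ_[ℓ] ↔ ¬ X.HasSplitMultiplicativeReduction ℤ_[ℓ] := by
    rw [hasSplitMultiplicativeReduction_quadraticTwist_iff ℤ_[ℓ] (isUnit_two_padicInt hℓ2) hXmult]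
    exact ⟨fun h hXs ↦ hnsq (h.mpr hXs), fun h ↦ ⟨fun hs ↦ absurd hs hnsq, fun hs ↦ absurd hs h⟩⟩
  have hXs_iff : W.HasSplitMultiplicativeReductionAtPrime ℓ ↔ X.HasSplitMultiplicativeReduction ℤ_[ℓ] :=
    hasSplitMultiplicativeReduction_iff_of_isMinimal_of_eq_smul ℤ_[ℓ] hC₁ hX0
  have hYs_iff : Wd.HasSplitMultiplicativeReductionAtPrime ℓ ↔ Y'.HasSplitMultiplicativeReduction ℤ_[ℓ] :=
    hasSplitMultiplicativeReduction_iff_of_isMinimal_of_eq_smul ℤ_[ℓ] hC₂' hY'0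
  have hmultd : Wd.HasMultiplicativeReductionAtPrime ℓ :=
    (hasMultiplicativeReduction_iff_of_isMinimal_of_eq_smul ℤ_[ℓ] hC₂' hY'0).mpr hY'mult
  obtain ⟨v, hv⟩ : ∃ v : HeightOneSpectrum ℤ, (primesEquiv v : ℕ) = ℓ :=
    ⟨primesEquiv.symm ⟨ℓ, Fact.out⟩, by rw [Equiv.apply_symm_apply]⟩
  have hΔ : padicValInt ℓ Wd.minimalDiscriminantInt = padicValInt ℓ W.minimalDiscriminantInt :=
    padicValInt_minimalDiscriminantInt_twist_eq_of_jacobiSym W K Cd hWd ℓ hℓ2 hJ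
  by_cases hXs : X.HasSplitMultiplicativeReduction ℤ_[ℓ]
  · -- `W` split at `ℓ`, `Wd` non-split (multiplicative)
    have hWs : W.HasSplitMultiplicativeReductionAtPrime ℓ := hXs_iff.mpr hXs
    have hWdns : ¬ Wd.HasSplitMultiplicativeReductionAtPrime ℓ :=
      fun h ↦ (hsplit.mp (hYs_iff.mp h)) hXs
    rw [padicValNat_localTamagawaNumber_eq_zero_of_mult_of_not_split Wd ℓ p hp2 hmultd hWdns,
      add_zero, localTamagawaNumber_eq_padicValInt_of_split W v hv hWs]
  · -- `W` non-split at `ℓ`, `Wd` split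
    have hWds : Wd.HasSplitMultiplicativeReductionAtPrime ℓ := hYs_iff.mpr (hsplit.mpr hXs)
    have hWns : ¬ W.HasSplitMultiplicativeReductionAtPrime ℓ := fun h ↦ hXs (hXs_iff.mp h)
    rw [padicValNat_localTamagawaNumber_eq_zero_of_mult_of_not_split W ℓ p hp2 hmult hWns, zero_add,
      localTamagawaNumber_eq_padicValInt_of_split Wd v hv hWds, hΔ]

end Inert

section InertTwo

variable (W : WeierstrassCurve ℚ) [W.IsElliptic] [W.IsGloballyMinimal]
  (K : Type) [Field K] [NumberField K]
  {Wd : WeierstrassCurve ℚ} [Wd.IsElliptic] [Wd.IsGloballyMinimal] (Cd : VariableChange ℚ)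
  (hWd : Cd • W.quadraticTwist (NumberField.discr K : ℚ) = Wd)
  (h8 : NumberField.discr K % 8 = 5)

include hWd h8

/-- **At `2` inert (`d_K ≡ 5 mod 8`) and multiplicative, the two Tamagawa exponents add up to at most
`ord_p(ord_2 Δ_min(E))`, for every ODD `p`** (multr1-p2's `…_le_of_inert_two` with `5 ≤ p ↦ p ≠ 2`):
one of `E`, `E^{d_K}` is split at `2` (`twist_two_of_mod_eight`), the other NON-split, `c_2 ∈ {1,2}`.
[cite: SilvermanATAEC1994, IV.9.4 Step 2 (PDF p. 344) and Cor. IV.9.2(d) (PDF p. 340)]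
[cite: SilvermanAEC2009, VII.5 Prop. 5.1(b) and App. A Prop. A.1.1] -/
theorem padicValNat_localTamagawaNumber_add_twist_le_of_inert_two_odd (p : ℕ) [Fact p.Prime]
    (hp2 : p ≠ 2) (hmult : Mult W 2) :
    padicValNat p ((W.baseChange ℚ_[2]).localTamagawaNumber ℤ_[2]) +
        padicValNat p ((Wd.baseChange ℚ_[2]).localTamagawaNumber ℤ_[2]) ≤
      padicValNat p (padicValInt 2 W.minimalDiscriminantInt) := by
  haveI : (W.baseChange ℚ_[2]).IsElliptic := inferInstanceAs (W.map (algebraMap ℚ ℚ_[2])).IsElliptic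
  haveI : (Wd.baseChange ℚ_[2]).IsElliptic := inferInstanceAs (Wd.map (algebraMap ℚ ℚ_[2])).IsElliptic
  obtain ⟨hΔ, h⟩ := twist_two_of_mod_eight W K Cd hWd h8
  obtain ⟨hmultd, hswap⟩ := h hmult
  obtain ⟨v, hv⟩ : ∃ v : HeightOneSpectrum ℤ, (primesEquiv v : ℕ) = 2 :=
    ⟨primesEquiv.symm ⟨2, Nat.prime_two⟩, by rw [Equiv.apply_symm_apply]⟩
  by_cases hWs : W.HasSplitMultiplicativeReductionAtPrime 2
  · have hWdns : ¬ Wd.HasSplitMultiplicativeReductionAtPrime 2 := fun hs ↦ (hswap.mp hs) hWs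
    rw [padicValNat_localTamagawaNumber_eq_zero_of_mult_of_not_split Wd 2 p hp2 hmultd hWdns,
      add_zero, localTamagawaNumber_eq_padicValInt_of_split W v hv hWs]
  · have hWds : Wd.HasSplitMultiplicativeReductionAtPrime 2 := hswap.mpr hWs
    rw [padicValNat_localTamagawaNumber_eq_zero_of_mult_of_not_split W 2 p hp2 hmult hWs, zero_add,
      localTamagawaNumber_eq_padicValInt_of_split Wd v hv hWds, hΔ]

end InertTwo

/-! ### The good primes of `E` under a twist by an ODD fundamental discriminant, odd `p` -/

section Good

variable (W : WeierstrassCurve ℚ) [W.IsElliptic] [W.IsGloballyMinimal]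
  (K : Type) [Field K] [NumberField K]
  {Wd : WeierstrassCurve ℚ} [Wd.IsElliptic] [Wd.IsGloballyMinimal] (Cd : VariableChange ℚ)
  (hWd : Cd • W.quadraticTwist (NumberField.discr K : ℚ) = Wd)
  (q : ℕ) [Fact q.Prime]

include hWd

/-- **At a prime of good reduction of `E`, `ord_p c_q(E) + ord_p c_q(E^{d_K}) = 0` for every ODD
`p`, when `d_K` is odd and every `q ∣ d_K` of good reduction is `≥ 5` (or `p ≥ 5`).** `c_q(E) = 1`;
`q ∤ d_K`: the twist keeps good reduction, `c = 1` (`X2.localTamagawaNumber_twist_of_not_dvd`);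
`q ∣ d_K`, `q ≥ 5`: `q ∥ d_K`, Kodaira `I₀*`, `ord_p c = 0` (`X2.padicValNat_localTamagawaNumber_twist_of_dvd`,
sub-cell eisenstein-p2); `p ≥ 5`: multr1-p2's `c ≤ 4 < p`. [cite: SilvermanATAEC1994, IV.9.4 Step 6 (PDF p. 345) and Table 4.1]
[cite: SilvermanAEC2009, VII.1 Prop. 1.3 and VII.5 Prop. 5.1(a)] -/
theorem padicValNat_localTamagawaNumber_add_twist_eq_zero_of_good_odd (p : ℕ) [Fact p.Prime]
    (hp2 : p ≠ 2) (h2 : Module.finrank ℚ K = 2) (hdodd : ¬ (2 : ℤ) ∣ NumberField.discr K)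
    (h5 : (q : ℤ) ∣ NumberField.discr K → 5 ≤ q ∨ 5 ≤ p) (hgood : W.HasGoodReductionAtPrime q) :
    padicValNat p ((W.baseChange ℚ_[q]).localTamagawaNumber ℤ_[q]) +
      padicValNat p ((Wd.baseChange ℚ_[q]).localTamagawaNumber ℤ_[q]) = 0 := by
  -- the `p ≥ 5` escape (Kodaira–Néron `c ≤ 4 < p`, multr1-p2) when a ramified good prime is `3`
  by_cases hesc : (q : ℤ) ∣ NumberField.discr K ∧ 5 ≤ p
  · exact padicValNat_localTamagawaNumber_add_twist_eq_zero_of_good W K Cd hWd q p hesc.2 hgood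
  set d : ℤ := NumberField.discr K with hd_def
  have hd0 : d ≠ 0 := by rw [hd_def]; exact NumberField.discr_ne_zero K
  haveI : (W.baseChange ℚ_[q]).IsElliptic := inferInstanceAs (W.map (algebraMap ℚ ℚ_[q])).IsElliptic
  -- `c_q(E) = 1`
  have hcW : (W.baseChange ℚ_[q]).localTamagawaNumber ℤ_[q] = 1 := by
    haveI : ((W.baseChange ℚ_[q]).minimal ℤ_[q]).HasGoodReduction ℤ_[q] := hgood
    exact localTamagawaNumber_eq_one_of_hasGoodReduction_holds ℤ_[q] _
  rw [hcW, padicValNat_one_right, zero_add]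
  -- `d_K ≡ 1 (mod 4)`: an odd field discriminant
  have h1 : d % 4 = 1 := by
    rcases Literature.NumberTheory.QuadraticFields.Quadratic.isFundamentalDiscriminant_discr
      (K := K) h2 with ⟨h, -, -⟩ | ⟨h4, -, -⟩
    · exact h
    · exact absurd (dvd_trans (by norm_num) h4) hdodd
  have hdk : d = 4 * (d / 4) + 1 := by omega
  by_cases hqd : (q : ℤ) ∣ d
  · -- ramified good prime: `q ≥ 5`, `q ∥ d_K`, Kodaira `I₀*`
    have hq5 : 5 ≤ q := (h5 hqd).resolve_right fun hp5 ↦ hesc ⟨hqd, hp5⟩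
    have hq2 : q ≠ 2 := by omega
    have hsq : ¬ (q : ℤ) ^ 2 ∣ d :=
      Literature.NumberTheory.QuadraticFields.Quadratic.not_sq_dvd_discr_of_prime_ne_two h2 Fact.out
        hq2
    exact X2.padicValNat_localTamagawaNumber_twist_of_dvd W p hp2 q hq5 hd0 hqd hsq hgood Cd hWd
  · -- unramified good prime: good reduction survives, `c = 1`
    rw [X2.localTamagawaNumber_twist_of_not_dvd W q hdk hqd hgood Cd hWd, padicValNat_one_right]

omit [Wd.IsElliptic] [Wd.IsGloballyMinimal] in
/-- **At a bad prime split in `K` (`c_q(E^{d_K}) = c_q(E)`), `ord_p c_q(E) + ord_p c_q(E^{d_K}) = 0`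
under the TAMAGAWA SHAPE at `q` ("`p ∣ c_q(E) ⇒` split multiplicative") and the très-ramifié clause
`p ∤ ord_q Δ_min`** (multr1-p2's `…_eq_zero_of_isSquare` with `5 ≤ p` replaced by the shape).
[cite: SilvermanATAEC1994, Cor. IV.9.2(d) (PDF p. 340)] [cite: SilvermanAEC2009, VII.6 Ex. 7.6 and X.5 Cor. 5.4] -/
theorem padicValNat_localTamagawaNumber_add_twist_eq_zero_of_isSquare_of_shape (p : ℕ)
    [Fact p.Prime] (hsq : IsSquare (algebraMap ℚ ℚ_[q] (NumberField.discr K : ℚ)))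
    (hshape : p ∣ (W.baseChange ℚ_[q]).localTamagawaNumber ℤ_[q] →
      W.HasSplitMultiplicativeReductionAtPrime q)
    (hFC : W.HasSplitMultiplicativeReductionAtPrime q → ¬ p ∣ padicValInt q W.minimalDiscriminantInt) :
    padicValNat p ((W.baseChange ℚ_[q]).localTamagawaNumber ℤ_[q]) +
      padicValNat p ((Wd.baseChange ℚ_[q]).localTamagawaNumber ℤ_[q]) = 0 := by
  haveI : (W.baseChange ℚ_[q]).IsElliptic := inferInstanceAs (W.map (algebraMap ℚ ℚ_[q])).IsElliptic
  rw [localTamagawaNumber_twist_eq_of_isSquare W K Cd hWd q hsq, ← two_mul, mul_eq_zero]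
  refine Or.inr ?_
  rw [padicValNat.eq_zero_of_not_dvd]
  intro hdvd
  have hs : W.HasSplitMultiplicativeReductionAtPrime q := hshape hdvd
  obtain ⟨v, hv⟩ : ∃ v : HeightOneSpectrum ℤ, (primesEquiv v : ℕ) = q :=
    ⟨primesEquiv.symm ⟨q, Fact.out⟩, by rw [Equiv.apply_symm_apply]⟩
  rw [localTamagawaNumber_eq_padicValInt_of_split W v hv hs] at hdvd
  exact hFC hs hdvd

end Good

/-! ### The numeric Tamagawa condition at the JSW field, odd `p` -/

section Global
/-- `ord_p` of a finite product of non-zero naturals is the sum of the `ord_p`. [folklore] -/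
private theorem padicValNat_finset_prod_odd (p : ℕ) [Fact p.Prime] {ι : Type*} (s : Finset ι)
    (f : ι → ℕ) (hf : ∀ i ∈ s, f i ≠ 0) :
    padicValNat p (∏ i ∈ s, f i) = ∑ i ∈ s, padicValNat p (f i) := by
  induction s using Finset.induction_on with
  | empty => simp
  | insert a s ha ih =>
    rw [Finset.prod_insert ha, Finset.sum_insert ha,
      padicValNat.mul (hf a (Finset.mem_insert_self a s))
        (Finset.prod_ne_zero_iff.mpr fun i hi => hf i (Finset.mem_insert_of_mem hi)),
      ih fun i hi => hf i (Finset.mem_insert_of_mem hi)]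

/-- **The numeric Tamagawa condition for the field of JSW §7.4.2 at every ODD `p` (`p = 3`
included)**: `K` quadratic with ODD discriminant, `Wd` a globally minimal model of `E^{d_K}`, `S` a set
of multiplicative primes inert in `K`, every other bad prime split, every split multiplicative `ℓ ∉ S`
très ramifié (`p ∤ ord_ℓ Δ_min`), every good `q ∣ d_K` `≥ 5` (or `p ≥ 5`), and the TAMAGAWA SHAPE
"`p ∣ c_q(E) ⇒` split multiplicative": `ord_p ∏c(E) + ord_p ∏c(E^{d_K}) ≤ Σ_{ℓ∈S} ord_p(ord_ℓ Δ_min(E))`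
(multr1-p2's `…_le_of_inertSet'` with `5 ≤ p` replaced by these hypotheses; prime by prime the four
lemmas above). [cite: JetchevSkinnerWan2017, §7.4.2 (p. 31) and §7.3.1 (eq:tamK)]
[cite: SilvermanATAEC1994, IV.9.4 Steps 2, 6 and Cor. IV.9.2(d)] -/
theorem padicValNat_tamagawaProduct_add_twist_le_of_inertSet'_odd
    (W : WeierstrassCurve ℚ) [W.IsElliptic] [W.IsGloballyMinimal] (p : ℕ) [Fact p.Prime]
    (hp2 : p ≠ 2) (K : Type) [Field K] [NumberField K] (h2 : Module.finrank ℚ K = 2)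
    (hdodd : ¬ (2 : ℤ) ∣ NumberField.discr K)
    (h5 : ∀ (q : ℕ) [Fact q.Prime], (q : ℤ) ∣ NumberField.discr K → W.HasGoodReductionAtPrime q →
      5 ≤ q ∨ 5 ≤ p)
    (hshape : ∀ (q : ℕ) [Fact q.Prime], p ∣ (W.baseChange ℚ_[q]).localTamagawaNumber ℤ_[q] →
      W.HasSplitMultiplicativeReductionAtPrime q)
    {Wd : WeierstrassCurve ℚ} [Wd.IsElliptic] [Wd.IsGloballyMinimal] (Cd : VariableChange ℚ)
    (hWd : Cd • W.quadraticTwist (NumberField.discr K : ℚ) = Wd)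
    (S : Finset ℕ)
    (hS : ∀ ℓ ∈ S, ∃ _ : Fact ℓ.Prime, Mult W ℓ ∧
      ((ℓ ≠ 2 ∧ jacobiSym (NumberField.discr K) ℓ = -1) ∨ (ℓ = 2 ∧ NumberField.discr K % 8 = 5)))
    (hsplit : ∀ (ℓ : ℕ) [Fact ℓ.Prime], ¬ W.HasGoodReductionAtPrime ℓ → ℓ ∉ S →
      IsSquare (algebraMap ℚ ℚ_[ℓ] (NumberField.discr K : ℚ)))
    (hFC : ∀ (ℓ : ℕ) [Fact ℓ.Prime], ℓ ∉ S → W.HasSplitMultiplicativeReductionAtPrime ℓ →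
      ¬ p ∣ padicValInt ℓ W.minimalDiscriminantInt) :
    padicValNat p W.tamagawaProduct + padicValNat p Wd.tamagawaProduct ≤
      ∑ ℓ ∈ S, padicValNat p (padicValInt ℓ W.minimalDiscriminantInt) := by
  have hp : p.Prime := Fact.out
  have hfW : (W.badPlaces ℤ).Finite := W.finite_badPlaces_holds ℤ
  have hfWd : (Wd.badPlaces ℤ).Finite := Wd.finite_badPlaces_holds ℤ
  set s : Finset (HeightOneSpectrum ℤ) := hfW.toFinset ∪ hfWd.toFinset with hs
  have hsW : ∀ v, ¬ W.HasGoodReductionAt v → v ∈ s := fun v hv ↦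
    Finset.mem_union_left _ (by rw [Set.Finite.mem_toFinset, mem_badPlaces_iff]; exact hv)
  have hsWd : ∀ v, ¬ Wd.HasGoodReductionAt v → v ∈ s := fun v hv ↦
    Finset.mem_union_right _ (by rw [Set.Finite.mem_toFinset, mem_badPlaces_iff]; exact hv)
  set f : HeightOneSpectrum ℤ → ℕ := fun v ↦
    haveI := Fact.mk (primesEquiv v).2
    padicValNat p ((W.baseChange ℚ_[primesEquiv v]).localTamagawaNumber ℤ_[primesEquiv v]) +
      padicValNat p ((Wd.baseChange ℚ_[primesEquiv v]).localTamagawaNumber ℤ_[primesEquiv v]) with hf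
  set g : ℕ → ℕ := fun ℓ ↦ padicValNat p (padicValInt ℓ W.minimalDiscriminantInt) with hg
  have hterm : ∀ v : HeightOneSpectrum ℤ,
      f v ≤ if (primesEquiv v : ℕ) ∈ S then g (primesEquiv v : ℕ) else 0 := by
    intro v
    haveI := Fact.mk (primesEquiv v).2
    have key : ∀ (q : ℕ) (hq : Fact q.Prime), (primesEquiv v : ℕ) = q →
        padicValNat p (@WeierstrassCurve.localTamagawaNumber ℤ_[q] _ _ _ ℚ_[q] _ _ _ (W.baseChange ℚ_[q])) +
          padicValNat p (@WeierstrassCurve.localTamagawaNumber ℤ_[q] _ _ _ ℚ_[q] _ _ _ (Wd.baseChange ℚ_[q])) ≤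
          if q ∈ S then g q else 0 := by
      rintro q hq hvq
      by_cases hqS : q ∈ S
      · obtain ⟨_, hmult, hcase⟩ := hS q hqS
        rw [if_pos hqS, hg]
        rcases hcase with ⟨hq2, hJ⟩ | ⟨rfl, h8⟩
        · exact padicValNat_localTamagawaNumber_add_twist_le_of_inert_odd W K Cd hWd q hq2 hJ p hp2
            hmult
        · exact padicValNat_localTamagawaNumber_add_twist_le_of_inert_two_odd W K Cd hWd h8 p hp2
            hmult
      · rw [if_neg hqS, Nat.le_zero]
        by_cases hgood : W.HasGoodReductionAtPrime q
        · exact padicValNat_localTamagawaNumber_add_twist_eq_zero_of_good_odd W K Cd hWd q p hp2 h2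
            hdodd (fun hqd ↦ h5 q hqd hgood) hgood
        · exact padicValNat_localTamagawaNumber_add_twist_eq_zero_of_isSquare_of_shape W K Cd hWd q p
            (hsplit q hgood hqS) (hshape q) (hFC q hqS)
    exact key _ _ rfl
  rw [tamagawaProduct_eq_prod W s hsW, tamagawaProduct_eq_prod Wd s hsWd,
    padicValNat_finset_prod_odd p s _ fun v _ ↦ ?_, padicValNat_finset_prod_odd p s _ fun v _ ↦ ?_,
    ← Finset.sum_add_distrib]
  · calc ∑ v ∈ s, f v
        ≤ ∑ v ∈ s, (if (primesEquiv v : ℕ) ∈ S then g (primesEquiv v : ℕ) else 0) :=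
          Finset.sum_le_sum fun v _ ↦ hterm v
      _ = ∑ ℓ ∈ s.image (fun v ↦ (primesEquiv v : ℕ)), (if ℓ ∈ S then g ℓ else 0) := by
          rw [Finset.sum_image]
          intro v _ w _ h
          exact primesEquiv.injective (Subtype.ext h)
      _ ≤ ∑ ℓ ∈ S, g ℓ := by
          rw [← Finset.sum_filter]
          refine Finset.sum_le_sum_of_subset_of_nonneg (fun ℓ hℓ ↦ (Finset.mem_filter.mp hℓ).2)
            fun _ _ _ ↦ Nat.zero_le _
  · haveI := Fact.mk (primesEquiv v).2
    haveI : (W.baseChange ℚ_[primesEquiv v]).IsElliptic :=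
      inferInstanceAs (W.map (algebraMap ℚ ℚ_[primesEquiv v])).IsElliptic
    exact localTamagawaNumber_padic_ne_zero_holds (primesEquiv v) _
  · haveI := Fact.mk (primesEquiv v).2
    haveI : (Wd.baseChange ℚ_[primesEquiv v]).IsElliptic :=
      inferInstanceAs (Wd.map (algebraMap ℚ ℚ_[primesEquiv v])).IsElliptic
    exact localTamagawaNumber_padic_ne_zero_holds (primesEquiv v) _

end Global

end Summit.BirchSwinnertonDyer.Rank1Residual.X11b

end
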